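import Summits.CriticalPhenomena.SAWScalingLimit.Theses.SAWExpCovariance
import Summits.CriticalPhenomena.SAWScalingLimit.Theorems.SAWLoopFugacityFlowAvoidanceDeterminesLaw
import Literature.Probability.RandomPlanarGeometry.SLEConvergenceCriterion
import HarnessLib.Audit

/-!
# Crux `DiscContinuity` (stmt-CriticalPhenomena-6755) — birth skeleton `Lines/birth.lean` (BC3)

Route `SAWExpCovariance` (sub-problem `SAWScalingLimit`), crux rank 3, BY NAME:
`Summit.CriticalPhenomena.SAWScalingLimit.Theses.SAWExpCovariance.DiscContinuity` — DOMAIN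
CONTINUITY OF THE SAW SCALING LIMIT in the Radó/Fréchet sense: for every scaling-limit family `P`
of the critical `δℤ²` SAW (`P` chordal with (lim)), if `Φₙ, Φ : C(ℂ, ℂ)` agree on the unit disc
with conformal equivalences onto Dobrushin domains `Dₙ`, `D` whose marked points are `Φₙ(∓1)`,
`Φ(∓1)`, and `Φₙ → Φ` uniformly on the CLOSED disc, then `P Dₙ → P D` weakly.

## The line ("tight + simple + avoidance-identified", the architecture of the sister birth
`Cruxes/LimitExists/Lines/birth.lean`, run ACROSS DOMAINS instead of across meshes)

Billingsley's subsequence principle (`Filter.tendsto_of_subseq_tendsto`): the real sequence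
`∫ f dP(Dₙ)` converges to `∫ f dP(D)` iff every subsequence has a further subsequence along which
it does.  Prokhorov (Mathlib `isCompact_closure_of_isTightMeasureSet`, sequential form
`exists_subseq_tendsto_of_tight` PROVED below) turns TIGHTNESS of `(P Dₙ)ₙ` into weak subsequential
limit points `ν` (probability measures on the Polish curve space `CurveClass ℂ`), and the tree's
PROVED uniqueness engine `AvoidanceDeterminesLaw_proof` (stmt-CriticalPhenomena-1373: two
probability laws carried by the SIMPLE boundary-avoiding chords of `(D; a, b)` with the same
hull-subdomain avoidance masses are equal) identifies every limit point with `P D` as soon as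
(i) `ν` and `P D` are carried by simple chords of `D` from `a` to `b` meeting `∂D` only at `a, b`,
and (ii) `ν {trace ⊆ cl D'} = P D {trace ⊆ cl D'}` for every hull subdomain `D' ⊆ D`.  Hence
three registered stubs, each a genuine statement about scaling-limit families of the critical SAW
under the crux's own hypotheses (the six geometric clauses are carried VERBATIM):

* `stub_domainTight` — (T) DOMAIN TIGHTNESS: along `Dₙ → D` (closed-disc uniformizers converging
  uniformly) the laws `P Dₙ` are eventually uniformly tight.  OPEN: needs Hölder / tortuosity
  (Aizenman–Burchard) regularity of the critical-SAW limit UNIFORM over a convergent family of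
  Jordan domains — the sub-sequential regularity of KemppainenSmirnov2017 is for FKG models, and
  for the SAW even fixed-domain eventual tightness (stmt-1372) is open.  L.
* `stub_limitPointsSimple` — (S) CARRIER OF THE LIMIT POINTS: every weak subsequential limit `ν`
  of `(P Dₙ)` is carried by SIMPLE chords of `cl D` from `a = D.pt 0` to `b = D.pt 1` meeting `∂D`
  only at `a, b` (the carrier clause of `AvoidanceDeterminesLaw`).  This is exactly the
  "no-crawling / boundary-avoidance near the moving marked points `aₙ → a`, `bₙ → b`" content of
  the crux's why-it-might-fail, plus stability of simplicity under weak limits (thin fjords of `Dₙ`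
  near `a` must not pinch macroscopic double points).  On the constant data `Dₙ = D` it contains
  the third clause of the route's `LimitAxioms` for `P D` itself.  OPEN; XL, the HARDEST.
* `stub_limitPointsAvoidance` — (A) AVOIDANCE MASSES OF THE LIMIT POINTS: every weak subsequential
  limit `ν` of `(P Dₙ)` gives each hull-subdomain event `{trace ⊆ cl D'}` (`D' ⊆ D` Dobrushin, same
  marked points, agreeing with `D` near `a, b`) the mass `P D {trace ⊆ cl D'}`.  The scalar,
  partition-function shadow of the crux: at the lattice level `P_{D,δ}(γ ⊆ cl D') = Z_δ(D')/Z_δ(D)`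
  (exact SAW restriction identity, LSW04 §3.4.5), so (A) is continuity IN THE DOMAIN of normalised
  SAW partition-function ratios, uniformly in the mesh, plus null touching of `∂D' ∖ ∂D` by limit
  points (portmanteau on the closed event).  OPEN; L.

`DiscContinuity_of (hT : Registered.stub_domainTight) (hS : Registered.stub_limitPointsSimple)
(hA : Registered.stub_limitPointsAvoidance) : DiscContinuity` is PROVED below (no placeholder;
the `Registered.stub_*` abbrevs are the stub statements keyed by stub name — the skeleton-check
convention): carrier of `P D` from (S) on the constant data `(D, Φ)` with the trivial limit point
`P D`; subsequence principle; strictly increasing re-indexing (`strictMono_subseq_of_tendsto_atTop`);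
tightness along it from (T); sequential Prokhorov; identification `ν = P D` by
`AvoidanceDeterminesLaw_proof` fed with (S), (S)-on-constant-data and (A).

All three stubs are CONSEQUENCES of the crux together with the route's `LimitAxioms` (limit points
of a convergent sequence ARE `P D`: `limitPointsAvoidance_of_discContinuity` below proves (A) from
the crux; (T) is Prokhorov's converse on a Polish space; (S) is the simplicity clause of
`LimitAxioms` for `P D`), so the line is exactly as safe as the route.  None is cheaply the crux
or the summit: BC3 probes `stub → DiscContinuity`, `stub → SAWScalingLimit` by
`first | exact? | simpa | aesop` FAIL for all three (planner folder `bc/DiscContinuity_probes.lean`).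

Placeholders: exactly 3 = the three `stub_*`; zero elsewhere.  Disproof used: none (no
`Disproof.lean` on this crux yet; `ledger crux ls stmt-CriticalPhenomena-6755`: no workfiles).
Negatives honoured (`ledger negatives --problem CriticalPhenomena`): stmt-0772 (all-`δ` tightness,
refuted by `SAWParafermionTight_refuted`) is not used — (T) is tightness of CONTINUUM laws across
domains, not of lattice laws across meshes; no stub drops a clause of the crux.

Sources: PommerenkeBBCM1992 (Thm 2.11, Radó), BillingsleyCPM1999 (Thm 2.6, Thm 5.1),
LawlerSchrammWerner2004SAW (§3.4.5 restriction identity, §4.1), LawlerSchrammWerner2003Restriction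
(Lemma 3.2: the law is determined by avoidance probabilities), KennedyLawler2013,
DuminilCopinHammond2013, AizenmanBurchardDuke1999, KemppainenSmirnov2017.
-/

noncomputable section

open MeasureTheory Filter Topology Set Metric Function
open Literature.Probability.RandomPlanarGeometry
open Literature.Probability.LatticeModels
open scoped ENNReal NNReal BoundedContinuousFunction Topology

namespace Summit.CriticalPhenomena.SAWScalingLimit.Cruxes.DiscContinuity.Birth

open Summit.CriticalPhenomena.SAWScalingLimit.Theorems.AvoidanceDeterminesLaw
  (AvoidanceDeterminesLaw_proof)

/-! ## 1. The statements of the line (over Literature / Mathlib declarations only) -/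

/-- **(T) Domain tightness.**  For every scaling-limit family `P` of the critical `δℤ²` SAW and
every convergent domain data of the crux (`Dₙ → D` through closed-disc uniformizers `Φₙ → Φ`
converging uniformly on the closed unit disc, marked points `Φₙ(∓1)`, `Φ(∓1)`), the laws `P Dₙ`
are eventually uniformly tight: for every `ε > 0` there is a compact `K ⊆ CurveClass ℂ` with
`P Dₙ Kᶜ ≤ ε` for all large `n`.  Intended from Aizenman–Burchard tortuosity bounds for the
critical SAW uniform over the domains `Dₙ ⊆ B(0, R)` (annulus-crossing probabilities), which are
open at `x_c`. [cite: AizenmanBurchardDuke1999, Thm 1.1] [cite: KemppainenSmirnov2017, Thm 1.5]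
[cite: BillingsleyCPM1999, Thm 5.1] -/
def DomainTight : Prop :=
  ∀ P : Literature.Probability.RandomPlanarGeometry.ChordalFamily, P.IsChordal → (∀ (D : Literature.Probability.RandomPlanarGeometry.DobrushinDomain) (a b : ℝ → Literature.Probability.LatticeModels.Site 2), Literature.Probability.RandomPlanarGeometry.SAW.IsEndpointApprox D a b → Literature.Probability.RandomPlanarGeometry.TendstoLaw (fun δ (γ : Literature.Probability.RandomPlanarGeometry.SAW.DomainSAW D.carrier δ (a δ) (b δ)) => γ.curve) (fun δ => Literature.Probability.RandomPlanarGeometry.SAW.law D.carrier δ (a δ) (b δ)) id (P D)) → ∀ (Dn : ℕ → Literature.Probability.RandomPlanarGeometry.DobrushinDomain) (D : Literature.Probability.RandomPlanarGeometry.DobrushinDomain) (Φn : ℕ → C(ℂ, ℂ)) (Φ : C(ℂ, ℂ)), (∀ n, ∃ g : Literature.Probability.RandomPlanarGeometry.ConformalEquiv (Metric.ball (0 : ℂ) 1) (Dn n).carrier, Set.EqOn (Φn n) g (Metric.ball (0 : ℂ) 1)) → (∃ g : Literature.Probability.RandomPlanarGeometry.ConformalEquiv (Metric.ball (0 : ℂ)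 1) D.carrier, Set.EqOn Φ g (Metric.ball (0 : ℂ) 1)) → (∀ n, (Dn n).pt 0 = Φn n (-1) ∧ (Dn n).pt 1 = Φn n 1) → D.pt 0 = Φ (-1) → D.pt 1 = Φ 1 → TendstoUniformlyOn (fun n => ((Φn n : C(ℂ, ℂ)) : ℂ → ℂ)) (Φ : ℂ → ℂ) Filter.atTop (Metric.closedBall (0 : ℂ) 1) → ∀ ε : ENNReal, 0 < ε → ∃ K : Set (Literature.Probability.RandomPlanarGeometry.CurveClass ℂ), IsCompact K ∧ ∀ᶠ n in Filter.atTop, P (Dn n) Kᶜ ≤ ε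

/-- **(S) Limit points are carried by the simple boundary-avoiding chords of `(D; a, b)`.**  For
every scaling-limit family `P`, every convergent domain data of the crux and every weak
subsequential limit `ν` of `(P Dₙ)` (a probability measure with `∫ f dP(D_{ns k}) → ∫ f dν` for
all bounded continuous `f`, `ns` strictly increasing), `ν`-a.e. curve class is simple, runs from
`D.pt 0` to `D.pt 1` inside `cl D` and meets `∂D` only at the two marked points.  The no-crawling /
boundary-avoidance content of the crux near the moving marked points, plus stability of
simplicity under weak limits; on constant data it is the simplicity clause of `LimitAxioms` for
`P D`.  The hardest stub. [cite: LawlerSchrammWerner2004SAW, §3.4 and §4.1]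
[cite: KennedyLawler2013] [cite: DuminilCopinHammond2013] -/
def LimitPointsSimple : Prop :=
  ∀ P : Literature.Probability.RandomPlanarGeometry.ChordalFamily, P.IsChordal → (∀ (D : Literature.Probability.RandomPlanarGeometry.DobrushinDomain) (a b : ℝ → Literature.Probability.LatticeModels.Site 2), Literature.Probability.RandomPlanarGeometry.SAW.IsEndpointApprox D a b → Literature.Probability.RandomPlanarGeometry.TendstoLaw (fun δ (γ : Literature.Probability.RandomPlanarGeometry.SAW.DomainSAW D.carrier δ (a δ) (b δ)) => γ.curve) (fun δ => Literature.Probability.RandomPlanarGeometry.SAW.law D.carrier δ (a δ) (b δ)) id (P D)) → ∀ (Dn : ℕ → Literature.Probability.RandomPlanarGeometry.DobrushinDomain) (D : Literature.Probability.RandomPlanarGeometry.DobrushinDomain) (Φn : ℕ → C(ℂ, ℂ)) (Φ : C(ℂ, ℂ)), (∀ n, ∃ g : Literature.Probability.RandomPlanarGeometry.ConformalEquiv (Metric.ball (0 : ℂ) 1) (Dn n).carrier, Set.EqOn (Φn n) g (Metric.ball (0 : ℂ) 1)) → (∃ g : Literature.Probability.RandomPlanarGeometry.ConformalEquiv (Metric.ball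 (0 : ℂ) 1) D.carrier, Set.EqOn Φ g (Metric.ball (0 : ℂ) 1)) → (∀ n, (Dn n).pt 0 = Φn n (-1) ∧ (Dn n).pt 1 = Φn n 1) → D.pt 0 = Φ (-1) → D.pt 1 = Φ 1 → TendstoUniformlyOn (fun n => ((Φn n : C(ℂ, ℂ)) : ℂ → ℂ)) (Φ : ℂ → ℂ) Filter.atTop (Metric.closedBall (0 : ℂ) 1) → ∀ (ns : ℕ → ℕ) (ν : MeasureTheory.Measure (Literature.Probability.RandomPlanarGeometry.CurveClass ℂ)), StrictMono ns → MeasureTheory.IsProbabilityMeasure ν → (∀ f : BoundedContinuousFunction (Literature.Probability.RandomPlanarGeometry.CurveClass ℂ) ℝ, Filter.Tendsto (fun k => ∫ γ, f γ ∂(P (Dn (ns k)))) Filter.atTop (nhds (∫ γ, f γ ∂ν))) → ∀ᵐ γ ∂ν, γ ∈ Literature.Probability.RandomPlanarGeometry.CurveClass.simple ∧ γ.source = D.pt 0 ∧ γ.target = D.pt 1 ∧ γ.range ⊆ closure D.carrier ∧ γ.range ∩ frontier D.carrier ⊆ {D.pt 0, D.pt 1}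

/-- **(A) Avoidance masses of the limit points.**  For every scaling-limit family `P`, every
convergent domain data of the crux and every weak subsequential limit `ν` of `(P Dₙ)`, and every
hull subdomain `D' ⊆ D` (Dobrushin, same marked points, agreeing with `D` near `a` and `b`),
`ν {trace ⊆ cl D'} = P D {trace ⊆ cl D'}`.  Lattice shadow: `P_{D,δ}(γ ⊆ cl D') = Z_δ(D')/Z_δ(D)`
(exact SAW restriction identity), so this is continuity in the domain of normalised critical-SAW
partition-function ratios, uniformly in the mesh, plus null touching of `∂D' ∖ ∂D` by limit
points. [cite: LawlerSchrammWerner2004SAW, §3.4.5] [cite: LawlerSchrammWerner2003Restriction, Lemma 3.2]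
[cite: KennedyLawler2013] -/
def LimitPointsAvoidance : Prop :=
  ∀ P : Literature.Probability.RandomPlanarGeometry.ChordalFamily, P.IsChordal → (∀ (D : Literature.Probability.RandomPlanarGeometry.DobrushinDomain) (a b : ℝ → Literature.Probability.LatticeModels.Site 2), Literature.Probability.RandomPlanarGeometry.SAW.IsEndpointApprox D a b → Literature.Probability.RandomPlanarGeometry.TendstoLaw (fun δ (γ : Literature.Probability.RandomPlanarGeometry.SAW.DomainSAW D.carrier δ (a δ) (b δ)) => γ.curve) (fun δ => Literature.Probability.RandomPlanarGeometry.SAW.law D.carrier δ (a δ) (b δ)) id (P D)) → ∀ (Dn : ℕ → Literature.Probability.RandomPlanarGeometry.DobrushinDomain) (D : Literature.Probability.RandomPlanarGeometry.DobrushinDomain) (Φn : ℕ → C(ℂ, ℂ)) (Φ : C(ℂ, ℂ)), (∀ n, ∃ g : Literature.Probability.RandomPlanarGeometry.ConformalEquiv (Metric.ball (0 : ℂ) 1) (Dn n).carrier, Set.EqOn (Φn n) g (Metric.ball (0 : ℂ) 1)) → (∃ g : Literature.Probability.RandomPlanarGeometry.ConformalEquiv (Metric.ball (0 : ℂ) 1)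 D.carrier, Set.EqOn Φ g (Metric.ball (0 : ℂ) 1)) → (∀ n, (Dn n).pt 0 = Φn n (-1) ∧ (Dn n).pt 1 = Φn n 1) → D.pt 0 = Φ (-1) → D.pt 1 = Φ 1 → TendstoUniformlyOn (fun n => ((Φn n : C(ℂ, ℂ)) : ℂ → ℂ)) (Φ : ℂ → ℂ) Filter.atTop (Metric.closedBall (0 : ℂ) 1) → ∀ (ns : ℕ → ℕ) (ν : MeasureTheory.Measure (Literature.Probability.RandomPlanarGeometry.CurveClass ℂ)), StrictMono ns → MeasureTheory.IsProbabilityMeasure ν → (∀ f : BoundedContinuousFunction (Literature.Probability.RandomPlanarGeometry.CurveClass ℂ) ℝ, Filter.Tendsto (fun k => ∫ γ, f γ ∂(P (Dn (ns k)))) Filter.atTop (nhds (∫ γ, f γ ∂ν))) → ∀ D' : Literature.Probability.RandomPlanarGeometry.DobrushinDomain, D'.carrier ⊆ D.carrier → D'.pt 0 = D.pt 0 → D'.pt 1 = D.pt 1 → (∃ ε : ℝ, 0 < ε ∧ D'.carrier ∩ Metric.ball (D.pt 0) ε = D.carrier ∩ Metric.ball (D.pt 0) ε ∧ D'.carrier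 ∩ Metric.ball (D.pt 1) ε = D.carrier ∩ Metric.ball (D.pt 1) ε) → ν (Literature.Probability.RandomPlanarGeometry.CurveClass.rangeSubset (closure D'.carrier)) = P D (Literature.Probability.RandomPlanarGeometry.CurveClass.rangeSubset (closure D'.carrier))

/-! ## 2. Registered stubs (statements LITERAL, so that the registered signatures are
self-contained over Literature / Mathlib declarations) -/

/-- STUB (T) — DOMAIN TIGHTNESS (`DomainTight`, literal).  L; open. -/
theorem stub_domainTight : ∀ P : Literature.Probability.RandomPlanarGeometry.ChordalFamily, P.IsChordal → (∀ (D : Literature.Probability.RandomPlanarGeometry.DobrushinDomain) (a b : ℝ → Literature.Probability.LatticeModels.Site 2), Literature.Probability.RandomPlanarGeometry.SAW.IsEndpointApprox D a b → Literature.Probability.RandomPlanarGeometry.TendstoLaw (fun δ (γ : Literature.Probability.RandomPlanarGeometry.SAW.DomainSAW D.carrier δ (a δ) (b δ)) => γ.curve) (fun δ => Literature.Probability.RandomPlanarGeometry.SAW.law D.carrier δ (a δ) (b δ)) id (P D)) → ∀ (Dn : ℕ → Literature.Probability.RandomPlanarGeometry.DobrushinDomain) (D : Literature.Probability.RandomPlanarGeometry.DobrushinDomain)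 (Φn : ℕ → C(ℂ, ℂ)) (Φ : C(ℂ, ℂ)), (∀ n, ∃ g : Literature.Probability.RandomPlanarGeometry.ConformalEquiv (Metric.ball (0 : ℂ) 1) (Dn n).carrier, Set.EqOn (Φn n) g (Metric.ball (0 : ℂ) 1)) → (∃ g : Literature.Probability.RandomPlanarGeometry.ConformalEquiv (Metric.ball (0 : ℂ) 1) D.carrier, Set.EqOn Φ g (Metric.ball (0 : ℂ) 1)) → (∀ n, (Dn n).pt 0 = Φn n (-1) ∧ (Dn n).pt 1 = Φn n 1) → D.pt 0 = Φ (-1) → D.pt 1 = Φ 1 → TendstoUniformlyOn (fun n => ((Φn n : C(ℂ, ℂ)) : ℂ → ℂ)) (Φ : ℂ → ℂ) Filter.atTop (Metric.closedBall (0 : ℂ) 1) → ∀ ε : ENNReal, 0 < ε → ∃ K : Set (Literature.Probability.RandomPlanarGeometry.CurveClass ℂ), IsCompact K ∧ ∀ᶠ n in Filter.atTop, P (Dn n) Kᶜ ≤ ε := by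
  sorry

/-- STUB (S) — CARRIER OF THE LIMIT POINTS (`LimitPointsSimple`, literal).  XL; open; the hardest. -/
theorem stub_limitPointsSimple : ∀ P : Literature.Probability.RandomPlanarGeometry.ChordalFamily, P.IsChordal → (∀ (D : Literature.Probability.RandomPlanarGeometry.DobrushinDomain) (a b : ℝ → Literature.Probability.LatticeModels.Site 2), Literature.Probability.RandomPlanarGeometry.SAW.IsEndpointApprox D a b → Literature.Probability.RandomPlanarGeometry.TendstoLaw (fun δ (γ : Literature.Probability.RandomPlanarGeometry.SAW.DomainSAW D.carrier δ (a δ) (b δ)) => γ.curve) (fun δ => Literature.Probability.RandomPlanarGeometry.SAW.law D.carrier δ (a δ) (b δ)) id (P D)) → ∀ (Dn : ℕ → Literature.Probability.RandomPlanarGeometry.DobrushinDomain) (D : Literature.Probability.RandomPlanarGeometry.DobrushinDomain) (Φn : ℕ → C(ℂ, ℂ)) (Φ : C(ℂ, ℂ)), (∀ n, ∃ g : Literature.Probability.RandomPlanarGeometry.ConformalEquiv (Metric.ball (0 : ℂ) 1) (Dn n).carrier, Set.EqOn (Φn n) g (Metric.ball (0 : ℂ) 1)) → (∃ g : Literature.Probability.RandomPlanarGeometry.ConformalEquiv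 (Metric.ball (0 : ℂ) 1) D.carrier, Set.EqOn Φ g (Metric.ball (0 : ℂ) 1)) → (∀ n, (Dn n).pt 0 = Φn n (-1) ∧ (Dn n).pt 1 = Φn n 1) → D.pt 0 = Φ (-1) → D.pt 1 = Φ 1 → TendstoUniformlyOn (fun n => ((Φn n : C(ℂ, ℂ)) : ℂ → ℂ)) (Φ : ℂ → ℂ) Filter.atTop (Metric.closedBall (0 : ℂ) 1) → ∀ (ns : ℕ → ℕ) (ν : MeasureTheory.Measure (Literature.Probability.RandomPlanarGeometry.CurveClass ℂ)), StrictMono ns → MeasureTheory.IsProbabilityMeasure ν → (∀ f : BoundedContinuousFunction (Literature.Probability.RandomPlanarGeometry.CurveClass ℂ) ℝ, Filter.Tendsto (fun k => ∫ γ, f γ ∂(P (Dn (ns k)))) Filter.atTop (nhds (∫ γ, f γ ∂ν))) → ∀ᵐ γ ∂ν, γ ∈ Literature.Probability.RandomPlanarGeometry.CurveClass.simple ∧ γ.source = D.pt 0 ∧ γ.target = D.pt 1 ∧ γ.range ⊆ closure D.carrier ∧ γ.range ∩ frontier D.carrier ⊆ {D.pt 0, D.pt 1} := by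
  sorry

/-- STUB (A) — AVOIDANCE MASSES OF THE LIMIT POINTS (`LimitPointsAvoidance`, literal).  L; open. -/
theorem stub_limitPointsAvoidance : ∀ P : Literature.Probability.RandomPlanarGeometry.ChordalFamily, P.IsChordal → (∀ (D : Literature.Probability.RandomPlanarGeometry.DobrushinDomain) (a b : ℝ → Literature.Probability.LatticeModels.Site 2), Literature.Probability.RandomPlanarGeometry.SAW.IsEndpointApprox D a b → Literature.Probability.RandomPlanarGeometry.TendstoLaw (fun δ (γ : Literature.Probability.RandomPlanarGeometry.SAW.DomainSAW D.carrier δ (a δ) (b δ)) => γ.curve) (fun δ => Literature.Probability.RandomPlanarGeometry.SAW.law D.carrier δ (a δ) (b δ)) id (P D)) → ∀ (Dn : ℕ → Literature.Probability.RandomPlanarGeometry.DobrushinDomain) (D : Literature.Probability.RandomPlanarGeometry.DobrushinDomain) (Φn : ℕ → C(ℂ, ℂ)) (Φ : C(ℂ, ℂ)), (∀ n, ∃ g : Literature.Probability.RandomPlanarGeometry.ConformalEquiv (Metric.ball (0 : ℂ) 1) (Dn n).carrier, Set.EqOn (Φn n) g (Metric.ball (0 : ℂ) 1)) → (∃ g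 : Literature.Probability.RandomPlanarGeometry.ConformalEquiv (Metric.ball (0 : ℂ) 1) D.carrier, Set.EqOn Φ g (Metric.ball (0 : ℂ) 1)) → (∀ n, (Dn n).pt 0 = Φn n (-1) ∧ (Dn n).pt 1 = Φn n 1) → D.pt 0 = Φ (-1) → D.pt 1 = Φ 1 → TendstoUniformlyOn (fun n => ((Φn n : C(ℂ, ℂ)) : ℂ → ℂ)) (Φ : ℂ → ℂ) Filter.atTop (Metric.closedBall (0 : ℂ) 1) → ∀ (ns : ℕ → ℕ) (ν : MeasureTheory.Measure (Literature.Probability.RandomPlanarGeometry.CurveClass ℂ)), StrictMono ns → MeasureTheory.IsProbabilityMeasure ν → (∀ f : BoundedContinuousFunction (Literature.Probability.RandomPlanarGeometry.CurveClass ℂ) ℝ, Filter.Tendsto (fun k => ∫ γ, f γ ∂(P (Dn (ns k)))) Filter.atTop (nhds (∫ γ, f γ ∂ν))) → ∀ D' : Literature.Probability.RandomPlanarGeometry.DobrushinDomain, D'.carrier ⊆ D.carrier → D'.pt 0 = D.pt 0 → D'.pt 1 = D.pt 1 → (∃ ε : ℝ, 0 < ε ∧ D'.carrier ∩ Metric.ball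 (D.pt 0) ε = D.carrier ∩ Metric.ball (D.pt 0) ε ∧ D'.carrier ∩ Metric.ball (D.pt 1) ε = D.carrier ∩ Metric.ball (D.pt 1) ε) → ν (Literature.Probability.RandomPlanarGeometry.CurveClass.rangeSubset (closure D'.carrier)) = P D (Literature.Probability.RandomPlanarGeometry.CurveClass.rangeSubset (closure D'.carrier)) := by
  sorry

/-! ## 3. Name-keyed aliases of the stub statements (skeleton-check convention: the hypotheses of
`DiscContinuity_of` are exactly the declared stubs, each BY NAME) -/

namespace Registered

/-- Alias keyed by the stub name: the statement of `stub_domainTight` (= `DomainTight`). -/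
abbrev stub_domainTight : Prop := DomainTight

/-- Alias keyed by the stub name: the statement of `stub_limitPointsSimple` (= `LimitPointsSimple`). -/
abbrev stub_limitPointsSimple : Prop := LimitPointsSimple

/-- Alias keyed by the stub name: the statement of `stub_limitPointsAvoidance`
(= `LimitPointsAvoidance`). -/
abbrev stub_limitPointsAvoidance : Prop := LimitPointsAvoidance

end Registered

/-! ## 4. Proved glue: sequential Prokhorov on a Polish space -/

section Prokhorov

variable {X : Type*} [MetricSpace X] [CompleteSpace X] [TopologicalSpace.SeparableSpace X]
  [MeasurableSpace X] [BorelSpace X]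

/-- **Sequential Prokhorov.**  An eventually uniformly tight sequence of probability measures on a
Polish metric space has a subsequence converging weakly (bounded continuous test functions) to a
probability measure.  (Mathlib's `isCompact_closure_of_isTightMeasureSet` on the range, made a
tight SET by the tree lemma `isTightMeasureSet_range_of_eventually`, then sequential compactness
of compact sets in the Lévy–Prokhorov-metrisable space `ProbabilityMeasure X`.)
[cite: BillingsleyCPM1999, Thm 5.1] -/
theorem exists_subseq_tendsto_of_tight (μ : ℕ → Measure X) (hμ : ∀ n, IsProbabilityMeasure (μ n))
    (h : ∀ ε : ℝ≥0∞, 0 < ε → ∃ K : Set X, IsCompact K ∧ ∀ᶠ n in atTop, μ n Kᶜ ≤ ε) :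
    ∃ (φ : ℕ → ℕ) (ν : Measure X), StrictMono φ ∧ IsProbabilityMeasure ν ∧
      ∀ f : X →ᵇ ℝ, Tendsto (fun n => ∫ x, f x ∂(μ (φ n))) atTop (𝓝 (∫ x, f x ∂ν)) := by
  haveI := hμ
  let P' : ℕ → ProbabilityMeasure X := fun n => ⟨μ n, hμ n⟩
  have htight : IsTightMeasureSet
      {((ρ : ProbabilityMeasure X) : Measure X) | ρ ∈ Set.range P'} := by
    have hrange : {((ρ : ProbabilityMeasure X) : Measure X) | ρ ∈ Set.range P'} =
        Set.range μ := by
      ext x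
      simp only [Set.mem_range, Set.mem_setOf_eq]
      constructor
      · rintro ⟨ρ, ⟨n, rfl⟩, rfl⟩
        exact ⟨n, rfl⟩
      · rintro ⟨n, rfl⟩
        exact ⟨P' n, ⟨n, rfl⟩, rfl⟩
    rw [hrange]
    exact isTightMeasureSet_range_of_eventually h
  have hcomp := isCompact_closure_of_isTightMeasureSet htight
  obtain ⟨ν, -, φ, hφ, hlim⟩ :=
    hcomp.isSeqCompact fun n => subset_closure (Set.mem_range_self n)
  refine ⟨φ, ν, hφ, inferInstance, fun f => ?_⟩
  have key := (ProbabilityMeasure.tendsto_iff_forall_integral_tendsto.1 hlim) f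
  exact key

end Prokhorov

/-! ## 5. The composition: the crux BY NAME from the three stubs -/

/-- **`DiscContinuity` from (T), (S), (A).**  Fix a scaling-limit family `P`, convergent domain
data `Dₙ → D` and a bounded continuous `f`.  By (S) on the constant data `(D, Φ)` (trivial limit
point `P D` along `ns = id`), `P D` is carried by the simple boundary-avoiding chords of
`(D; a, b)`.  By the subsequence principle it suffices to extract, from every `ns → ∞`, a further
subsequence along which `∫ f dP(D_{ns ·}) → ∫ f dP(D)`: re-index `ns` strictly increasingly, get
eventual tightness along it from (T), a weak limit point `ν` from sequential Prokhorov, its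
carrier from (S) and its avoidance masses from (A); the tree's `AvoidanceDeterminesLaw_proof`
gives `ν = P D`. [cite: BillingsleyCPM1999, Thm 2.6 and Thm 5.1]
[cite: LawlerSchrammWerner2003Restriction, Lemma 3.2] -/
theorem DiscContinuity_of (hT : Registered.stub_domainTight)
    (hS : Registered.stub_limitPointsSimple) (hA : Registered.stub_limitPointsAvoidance) :
    Summit.CriticalPhenomena.SAWScalingLimit.Theses.SAWExpCovariance.DiscContinuity := by
  intro P hch hlim Dn D Φn Φ hgn hg hptn hpt0 hpt1 hunif f
  -- `P D` is a probability measure carried by the simple boundary-avoiding chords of `(D; a, b)`: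
  -- stub (S) on the constant data `(D, Φ)` with the trivial limit point `P D`
  have hPDprob : IsProbabilityMeasure (P D) := (hch D).1
  have hconst : TendstoUniformlyOn (fun _ : ℕ => ((Φ : C(ℂ, ℂ)) : ℂ → ℂ)) (Φ : ℂ → ℂ)
      Filter.atTop (Metric.closedBall (0 : ℂ) 1) :=
    fun u hu => Eventually.of_forall fun _ _ _ => refl_mem_uniformity hu
  have hconv : ∀ g : CurveClass ℂ →ᵇ ℝ,
      Tendsto (fun _ : ℕ => ∫ γ, g γ ∂(P D)) atTop (𝓝 (∫ γ, g γ ∂(P D))) :=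
    fun _ => tendsto_const_nhds
  have hPDcar : ∀ᵐ γ ∂(P D), γ ∈ CurveClass.simple ∧ γ.source = D.pt 0 ∧ γ.target = D.pt 1 ∧
      γ.range ⊆ closure D.carrier ∧ γ.range ∩ frontier D.carrier ⊆ {D.pt 0, D.pt 1} :=
    hS P hch hlim (fun _ => D) D (fun _ => Φ) Φ (fun _ => hg) hg (fun _ => ⟨hpt0, hpt1⟩)
      hpt0 hpt1 hconst id (P D) strictMono_id hPDprob hconv
  -- the subsequence principle
  refine tendsto_of_subseq_tendsto fun ns hns => ?_
  -- re-index `ns` strictly increasingly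
  obtain ⟨φ₁, -, hmono⟩ := strictMono_subseq_of_tendsto_atTop hns
  -- eventual tightness along the re-indexed sequence, from (T)
  have hprob : ∀ k, IsProbabilityMeasure (P (Dn (ns (φ₁ k)))) := fun k => (hch _).1
  have htight : ∀ ε : ℝ≥0∞, 0 < ε → ∃ K : Set (CurveClass ℂ), IsCompact K ∧
      ∀ᶠ k in atTop, P (Dn (ns (φ₁ k))) Kᶜ ≤ ε := by
    intro ε hε
    obtain ⟨K, hK, hev⟩ := hT P hch hlim Dn D Φn Φ hgn hg hptn hpt0 hpt1 hunif ε hε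
    exact ⟨K, hK, hmono.tendsto_atTop.eventually hev⟩
  -- sequential Prokhorov: a further subsequence has a weak limit point `ν`
  obtain ⟨φ₂, ν, hφ₂, hν, hlimν⟩ :=
    exists_subseq_tendsto_of_tight (fun k => P (Dn (ns (φ₁ k)))) hprob htight
  -- identification of the limit point: `ν = P D`
  have hsm : StrictMono (fun k => ns (φ₁ (φ₂ k))) := fun a b hab => hmono (hφ₂ hab)
  have hνcar : ∀ᵐ γ ∂ν, γ ∈ CurveClass.simple ∧ γ.source = D.pt 0 ∧ γ.target = D.pt 1 ∧
      γ.range ⊆ closure D.carrier ∧ γ.range ∩ frontier D.carrier ⊆ {D.pt 0, D.pt 1} :=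
    hS P hch hlim Dn D Φn Φ hgn hg hptn hpt0 hpt1 hunif (fun k => ns (φ₁ (φ₂ k))) ν hsm hν hlimν
  have hνav := hA P hch hlim Dn D Φn Φ hgn hg hptn hpt0 hpt1 hunif (fun k => ns (φ₁ (φ₂ k))) ν
    hsm hν hlimν
  have hνeq : ν = P D :=
    AvoidanceDeterminesLaw_proof D ν (P D) hν hPDprob hνcar hPDcar
      (fun D' hsub h0 h1 hε => hνav D' hsub h0 h1 hε)
  refine ⟨fun k => φ₁ (φ₂ k), ?_⟩
  have h := hlimν f
  rw [hνeq] at h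
  exact h

/-- Wiring check: the crux BY NAME from the three registered (placeholder) stubs — the stub
theorems are exactly the hypotheses of `DiscContinuity_of` (this declaration inherits their
placeholders through them; nothing is claimed). -/
theorem DiscContinuity_wiring :
    Summit.CriticalPhenomena.SAWScalingLimit.Theses.SAWExpCovariance.DiscContinuity :=
  DiscContinuity_of stub_domainTight stub_limitPointsSimple stub_limitPointsAvoidance

/-! ## 6. Sanity: necessity of (A) -/

/-- Under the crux every weak subsequential limit `ν` of `(P Dₙ)` IS `P D` (uniqueness of weak
limits of probability measures on a Polish space, `ext_of_forall_integral_eq_of_IsFiniteMeasure`),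
so it has the avoidance masses of `P D`: stub (A) is a CONSEQUENCE of `DiscContinuity`, hence
exactly as safe as the crux. [cite: BillingsleyCPM1999, Thm 2.6] -/
theorem limitPointsAvoidance_of_discContinuity
    (h : Summit.CriticalPhenomena.SAWScalingLimit.Theses.SAWExpCovariance.DiscContinuity) :
    LimitPointsAvoidance := by
  intro P hch hlim Dn D Φn Φ hgn hg hptn hpt0 hpt1 hunif ns ν hns hν hconv D' _ _ _ _
  haveI := (hch D).1
  haveI := hν
  have hνeq : ν = P D := by
    refine ext_of_forall_integral_eq_of_IsFiniteMeasure fun g => ?_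
    have h1 := hconv g
    have h2 : Tendsto (fun k => ∫ γ, g γ ∂(P (Dn (ns k)))) atTop (𝓝 (∫ γ, g γ ∂(P D))) :=
      (h P hch hlim Dn D Φn Φ hgn hg hptn hpt0 hpt1 hunif g).comp hns.tendsto_atTop
    exact tendsto_nhds_unique h1 h2
  rw [hνeq]

end Summit.CriticalPhenomena.SAWScalingLimit.Cruxes.DiscContinuity.Birth
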